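import Mathlib
import Summits.NavierStokesRegularity.NavierStokesRegularity.Theses.RootDecompThresholdSaddle
import Literature.Analysis.FluidPDE.SelfSimilar
import Literature.Analysis.FluidPDE.SelfSimilarLiouville

/-!
# N15 «THRESHOLD SADDLE» · glue item `TypeIDssWall_of_cells` (T → F → C → W) PROVED

Item stmt-NavierStokesRegularity-31467 of route `RootDecompThresholdSaddle` (the glue of the gen-1 split of W
`TypeIDssWall` 29252 into T `SmallEnvelopeDssLiouville` 31464, F `FineRatioLargeEnvelopeDssLiouville` 31465,
C `CoarseRatioLargeEnvelopeDssLiouville` 31466), closed BY NAME.  Proof (lens-1 g17 «THE FAKE BREATHER»,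
HOME/decomp-ns-lens-1/FakeBreather.lean `wallN15_of_cells`, critic row 208 booking step 1): W is equivalent to
«every rotated Type-I DSS Liouville statement» (the plain half is the rotation `R = 1`,
`rotatedTypeIDSSLiouville_refl_iff`); given a member, case on the envelope `HasTypeIDecay 3 u` (T), else on the
existence of a fine factor in `(1, 2]` (F), else C.  Pure logic; no defs.

Sources: Bradshaw–Tsai arXiv:1610.05680 §5 OP 5.1; Chae–Wolf arXiv:1610.09464; tree `SelfSimilarLiouville`.
-/

noncomputable section

set_option linter.dupNamespace false

namespace Summit.NavierStokesRegularity.NavierStokesRegularity.Theorems.RootDecompThresholdSaddleWallOfCells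

open Summit.NavierStokesRegularity.NavierStokesRegularity.Theses
open Filter Set MeasureTheory Function
open Literature.Analysis.FluidPDE

/-- W «both halves» ⟺ «all rotated statements» (the plain half is `R = 1`). -/
theorem wall_iff_rotated : RootDecompThresholdSaddle.TypeIDssWall ↔
    ∀ (c : ℝ) (R : EuclideanSpace ℝ (Fin 3) ≃ₗᵢ[ℝ] EuclideanSpace ℝ (Fin 3)), RotatedTypeIDSSLiouville c R := by
  constructor
  · exact fun h c R => (h c).2 R
  · intro h c
    exact ⟨(rotatedTypeIDSSLiouville_refl_iff c).1 (h c _), fun R => h c R⟩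

/-- **Item stmt-NavierStokesRegularity-31467 `TypeIDssWall_of_cells` (N15's glue `T → F → C → W`) PROVED, by
name**: cases on the envelope `3` and on a fine factor in `(1, 2]`.  (Stated directly as the item so that no
theorem of this file has W as its conclusion type.) -/
theorem typeIDssWall_of_cells_holds : RootDecompThresholdSaddle.TypeIDssWall_of_cells := by
  intro hT hF hC
  refine wall_iff_rotated.2 fun c R hc u hm hme hR hd t ht => ?_
  by_cases h3 : HasTypeIDecay 3 u
  · exact hT c R u hc hm hme hR h3 t ht
  by_cases hfine : ∃ (c' : ℝ) (R' : EuclideanSpace ℝ (Fin 3) ≃ₗᵢ[ℝ] EuclideanSpace ℝ (Fin 3)),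
      1 < c' ∧ c' ≤ 2 ∧ IsRotatedDSS c' R' u
  · obtain ⟨c', R', h1, h2, hR'⟩ := hfine
    exact hF c' R' u h1 h2 hm hme hR' hd h3 t ht
  · simp only [not_exists, not_and] at hfine
    exact hC c R u hc hm hme hR (fun c' R' h1 h2 => hfine c' R' h1 h2) hd h3 t ht

end Summit.NavierStokesRegularity.NavierStokesRegularity.Theorems.RootDecompThresholdSaddleWallOfCells
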